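import Literature.MathematicalPhysics.QuantumLattice.HubbardRectTorusPlaquetteDressedBound
import Literature.MathematicalPhysics.QuantumLattice.HubbardNNNHoppingOpenClusters
import HarnessLib

/-!
# The plaquette-dressed Slater bound on the OPEN `2M × 2M'` box with `t–t'` hopping

Topic `MathematicalPhysics/QuantumLattice`, family `hubbard`. The free-boundary, next-nearest-neighbour
companion of `HubbardRectTorusPlaquetteDressedBound.lean`: the abstract dressed-cluster
(local-unitary-cluster, LUC) variational bound `DressedCluster.groundEnergy_le` instantiated for the
`t–t'` Hubbard Hamiltonian of the OPEN box `hubbardOpenBoxTT' (M * 2) (M' * 2) t t' U`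
(`HubbardNNNHoppingOpenClusters.lean`; vertex set `Fin (2M) ×ₗ Fin (2M')`, free boundary conditions,
nearest-neighbour bonds `rectBoxGraph`, diagonal bonds `rectBoxDiagGraph`), tiled by the `M · M'`
disjoint `2 × 2` plaquettes `rectCellSite c · ` (`c ∈ Fin M × Fin M'`, the charts of the rectangular
file). There is no wrap-around, so no hypothesis `2 ≤ M` is needed, and the bonds between plaquettes
come in two kinds:

* AXIAL links `ℓ = (c, c', e) : BoxLink M M'` (`c' = c + e` inside the box, `PlaquetteLUC.IsStep`):
  the window `{0,1} × {0,1}²` (first copy = plaquette `c`, second copy = `c'`, chart `boxLinkEmb ℓ`)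
  carries the two nearest-neighbour middle bonds (`PlaquetteLUC.linkGraph e`, square file) AND the two
  diagonal bonds between the facing sides (`linkDiagGraph e`);
* CORNER links `ℓ = (c, c', d) : BoxCorner M M'` (`c' = c + (1, 1)` for `d = 0`, `c' = c + (1, -1)`
  for `d = 1`, inside the box, `PlaquetteLUC.IsCorner`): the window carries the single diagonal bond
  between the facing corners (`cornerGraph d`);

and inside a plaquette the two diagonals form `plaquetteDiagGraph`. Results:

* `openBox_hamiltonian_eq_sum_cells_add_sum_links` (private) — **bond partition**
  `H^{open}_{2M×2M'}(t,t',U) = Σ_c Γ(cell c)(H_plaq(t,U) + D_plaq(t'))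
     + Σ_{ℓ axial} Γ(link ℓ)(T_e(t) + D_e(t')) + Σ_{ℓ corner} Γ(corner ℓ) C_d(t')`:
  every nearest-neighbour bond of the box lies in exactly one plaquette or one axial link, every
  diagonal bond in exactly one plaquette, one axial link or one corner link;
* `groundEnergy_openBox_le_dressed` — **the bound**: for every orthogonal projection `P` on the
  one-particle space of the box with `tr P = N` and every family of particle-number conserving
  unitaries `u_c` of the plaquette Fock space,
  `E^{open}_{2M×2M'}(t,t',U; N) ≤ Re [ Σ_c Σ_{s,t} (u_cᴴ (H_plaq + D_plaq) u_c)_{st} ρ_P^{cell c}(s,t)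
     + Σ_{ℓ axial} Σ_{s,t} (V_ℓᴴ (T_e + D_e) V_ℓ)_{st} ρ_P^{link ℓ}(s,t)
     + Σ_{ℓ corner} Σ_{s,t} (V_ℓᴴ C_d V_ℓ)_{st} ρ_P^{corner ℓ}(s,t) ]`,
  `V_ℓ = Γ(inl) u_c · Γ(inr) u_{c'}`, `ρ_P^φ = slaterRDM (P|_φ)`;
* `energyDensityTT'_le_openBox_dressed` — the thermodynamic-limit corollary
  `e(t,t',U; N/(4MM')) ≤ (the same right-hand side)/(4MM')` (`U ≥ 0`, `N < 8MM'`), by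
  `ThermodynamicLimit.energyDensityTT'_le_openBox`.

This is the soundness statement behind exact-ℚ "open-box plaquette-LUC" upper certificates for the
`t–t'` energy density (a Slater determinant of the free box dressed by one optimised unitary per
plaquette, evaluated window by window by Wick's theorem). Sources: Bach–Lieb–Solovej 1994,
eq. (2c.36) [BachLiebSolovej1994]; Bratteli–Robinson II §5.2.2 [BratteliRobinsonII1997]; LeBlanc et al.
2015, eq. (1) (the `t–t'` model, open clusters) [LeBlancEtAl2015]; Ruelle 1969 §3.3 (thermodynamic
limit) [Ruelle1969]; the tiling is elementary [folklore]. Everything is proved; definitions have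
bodies; no named facts. The tiling lemmas are file-private plumbing.
-/

noncomputable section

namespace Literature.MathematicalPhysics.QuantumLattice

open Matrix Finset HubbardWave0 Literature.Probability.LatticeModels
open scoped ComplexOrder Function

namespace PlaquetteLUC

variable {M M' : ℕ}

/-! ### §1. Cell coordinates (charts of the rectangular file, box-interior neighbour relations) -/

/-- First coordinate of a cell site. [folklore] -/
@[simp] private theorem ofLex_rectCellSite_fst' (c : Fin M × Fin M') (a : FermionTorus 2 2) :
    (ofLex (rectCellSite c a)).1 = finProdFinEquiv (c.1, ofLex a 0) := rfl

/-- Second coordinate of a cell site. [folklore] -/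
@[simp] private theorem ofLex_rectCellSite_snd' (c : Fin M × Fin M') (a : FermionTorus 2 2) :
    (ofLex (rectCellSite c a)).2 = finProdFinEquiv (c.2, ofLex a 1) := rfl

/-- Two offsets of `{0,1}²` agree iff both coordinates agree. [folklore] -/
private theorem offset_eq_iff' (a b : FermionTorus 2 2) : a = b ↔ ofLex a 0 = ofLex b 0 ∧ ofLex a 1 = ofLex b 1 := by
  constructor
  · rintro rfl; exact ⟨rfl, rfl⟩
  · rintro ⟨h0, h1⟩
    refine ofLex.injective (funext fun i => ?_)
    fin_cases i
    · exact h0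
    · exact h1

/-- `rectCellSite` is jointly injective. [folklore] -/
private theorem rectCellSite_inj' {c c' : Fin M × Fin M'} {a b : FermionTorus 2 2} :
    rectCellSite c a = rectCellSite c' b ↔ c = c' ∧ a = b := by
  constructor
  · intro h
    have h1 := congrArg (fun p => (ofLex p).1) h
    have h2 := congrArg (fun p => (ofLex p).2) h
    simp only [ofLex_rectCellSite_fst', ofLex_rectCellSite_snd', EmbeddingLike.apply_eq_iff_eq,
      Prod.mk.injEq] at h1 h2
    exact ⟨Prod.ext h1.1 h2.1, (offset_eq_iff' a b).2 ⟨h1.2, h2.2⟩⟩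
  · rintro ⟨rfl, rfl⟩; rfl

/-- Cell coordinates are a bijection `(Fin M × Fin M') × {0,1}² → Fin 2M × Fin 2M'`. [folklore] -/
private theorem rectCellSite_bijective' :
    Function.Bijective (fun p : (Fin M × Fin M') × FermionTorus 2 2 => rectCellSite p.1 p.2) := by
  rw [Fintype.bijective_iff_injective_and_card]
  refine ⟨fun p q h => Prod.ext (rectCellSite_inj'.1 h).1 (rectCellSite_inj'.1 h).2, ?_⟩
  rw [Fintype.card_prod, Fintype.card_prod, Fintype.card_fin, Fintype.card_fin, card_rectSites]
  change M * M' * Fintype.card (Fin 2 → Fin 2) = _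
  rw [Fintype.card_fun, Fintype.card_fin]
  ring

/-- `rectCellEmb c a = rectCellSite c a`. [folklore] -/
@[simp] private theorem rectCellEmb_apply' (c : Fin M × Fin M') (a : FermionTorus 2 2) :
    rectCellEmb c a = rectCellSite c a := rfl

/-- Distinct plaquettes are disjoint. [folklore] -/
private theorem disjoint_rectCellEmb' {c c' : Fin M × Fin M'} (h : c ≠ c') :
    Disjoint ((univ : Finset (FermionTorus 2 2)).map (rectCellEmb c)) (univ.map (rectCellEmb c')) := by
  rw [Finset.disjoint_left]
  rintro x hx hx'
  obtain ⟨a, -, rfl⟩ := Finset.mem_map.1 hx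
  obtain ⟨b, -, hb⟩ := Finset.mem_map.1 hx'
  exact h (rectCellSite_inj'.1 hb).1.symm

/-- **The axial neighbour relation of plaquettes inside the box**: `c' = c + e` with `e₀ = (1,0)`,
`e₁ = (0,1)`, in `ℕ`-coordinates (no wrap-around) — the pairs of `2 × 2` plaquettes of the open
cluster joined by nearest-neighbour bonds `⟨i,j⟩` (and by two of the next-nearest-neighbour bonds
`⟨⟨i,j⟩⟩`) of the `t–t'` Hamiltonian, LeBlanc et al. (2015) eq. (1), in plaquette coordinates.
[cite: LeBlancEtAl2015, eq. (1)] -/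
def IsStep (e : Fin 2) (c c' : Fin M × Fin M') : Prop :=
  (c'.1 : ℕ) = c.1 + (if e = 0 then 1 else 0) ∧ (c'.2 : ℕ) = c.2 + (if e = 0 then 0 else 1)

/-- `IsStep` is decidable. [folklore] -/
instance instDecidableIsStep (e : Fin 2) (c c' : Fin M × Fin M') : Decidable (IsStep e c c') :=
  inferInstanceAs (Decidable (_ ∧ _))

/-- **The diagonal (corner) neighbour relation of plaquettes inside the box**: `c' = c + (1, 1)`
(`d = 0`) or `c' = c + (1, -1)` (`d = 1`), in `ℕ`-coordinates — the pairs of plaquettes of the open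
cluster joined by exactly one next-nearest-neighbour bond `⟨⟨i,j⟩⟩` of LeBlanc et al. (2015) eq. (1).
[cite: LeBlancEtAl2015, eq. (1)] -/
def IsCorner (d : Fin 2) (c c' : Fin M × Fin M') : Prop :=
  (c'.1 : ℕ) = c.1 + 1 ∧ (if d = 0 then (c'.2 : ℕ) = c.2 + 1 else (c.2 : ℕ) = c'.2 + 1)

/-- `IsCorner` is decidable. [folklore] -/
instance instDecidableIsCorner (d : Fin 2) (c c' : Fin M × Fin M') : Decidable (IsCorner d c c') := by
  unfold IsCorner; infer_instance

/-- An axial neighbour is a different plaquette. [folklore] -/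
private theorem IsStep.ne {e : Fin 2} {c c' : Fin M × Fin M'} (h : IsStep e c c') : c ≠ c' := by
  rintro rfl
  obtain ⟨h1, h2⟩ := h
  fin_cases e <;> simp at h1 h2

/-- A corner neighbour is a different plaquette. [folklore] -/
private theorem IsCorner.ne {d : Fin 2} {c c' : Fin M × Fin M'} (h : IsCorner d c c') : c ≠ c' := by
  rintro rfl
  obtain ⟨h1, -⟩ := h
  omega

/-- **The axial links of the open box of `M × M'` plaquettes**: the triples `ℓ = (c, c', e)` with
`c' = c + e` inside the box (`ℓ.1.1 = c`, `ℓ.1.2.1 = c'`, `ℓ.1.2.2 = e`). [folklore] -/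
abbrev BoxLink (M M' : ℕ) : Type :=
  {ℓ : (Fin M × Fin M') × (Fin M × Fin M') × Fin 2 // IsStep ℓ.2.2 ℓ.1 ℓ.2.1}

/-- **The corner links of the open box of `M × M'` plaquettes**: the triples `ℓ = (c, c', d)` with
`c' = c + (1, ±1)` inside the box (`ℓ.1.1 = c`, `ℓ.1.2.1 = c'`, `ℓ.1.2.2 = d`). [folklore] -/
abbrev BoxCorner (M M' : ℕ) : Type :=
  {ℓ : (Fin M × Fin M') × (Fin M × Fin M') × Fin 2 // IsCorner ℓ.2.2 ℓ.1 ℓ.2.1}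

/-- The chart of a two-plaquette window made of the plaquettes `c` (first copy) and `c'` (second
copy): `(i, a) ↦ rectCellSite (if i = 0 then c else c') a`. [folklore] -/
def pairSite (c c' : Fin M × Fin M') (p : Fin 2 ×ₗ FermionTorus 2 2) : Fin (M * 2) ×ₗ Fin (M' * 2) :=
  rectCellSite (if (ofLex p).1 = 0 then c else c') (ofLex p).2

/-- `pairSite c c'` is injective for distinct plaquettes. [folklore] -/
private theorem pairSite_injective {c c' : Fin M × Fin M'} (hcc : c ≠ c') :
    Function.Injective (pairSite c c') := by
  intro p q h
  rw [pairSite, pairSite, rectCellSite_inj'] at h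
  obtain ⟨h1, h2⟩ := h
  have hi : (ofLex p).1 = (ofLex q).1 := by
    by_contra hne
    rcases Fin.eq_zero_or_eq_succ (ofLex p).1 with hp | ⟨k, hk⟩ <;>
      rcases Fin.eq_zero_or_eq_succ (ofLex q).1 with hq | ⟨l, hl⟩
    · exact hne (hp.trans hq.symm)
    · rw [hp, hl, if_pos rfl, if_neg (Fin.succ_ne_zero l)] at h1
      exact hcc h1
    · rw [hk, hq, if_neg (Fin.succ_ne_zero k), if_pos rfl] at h1
      exact hcc h1.symm
    · apply hne; rw [hk, hl, Fin.eq_zero k, Fin.eq_zero l]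
  exact ofLex.injective (Prod.ext hi h2)

/-- The chart of the axial link window `ℓ = (c, c', e)`. [folklore] -/
def boxLinkEmb (ℓ : BoxLink M M') : Fin 2 ×ₗ FermionTorus 2 2 ↪ Fin (M * 2) ×ₗ Fin (M' * 2) :=
  ⟨pairSite ℓ.1.1 ℓ.1.2.1, pairSite_injective ℓ.2.ne⟩

/-- The chart of the corner link window `ℓ = (c, c', d)`. [folklore] -/
def boxCornerEmb (ℓ : BoxCorner M M') : Fin 2 ×ₗ FermionTorus 2 2 ↪ Fin (M * 2) ×ₗ Fin (M' * 2) :=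
  ⟨pairSite ℓ.1.1 ℓ.1.2.1, pairSite_injective ℓ.2.ne⟩

/-- `boxLinkEmb` unfolded. [folklore] -/
@[simp] private theorem boxLinkEmb_apply (ℓ : BoxLink M M') (p : Fin 2 ×ₗ FermionTorus 2 2) :
    boxLinkEmb ℓ p = rectCellSite (if (ofLex p).1 = 0 then ℓ.1.1 else ℓ.1.2.1) (ofLex p).2 := rfl

/-- `boxCornerEmb` unfolded. [folklore] -/
@[simp] private theorem boxCornerEmb_apply (ℓ : BoxCorner M M') (p : Fin 2 ×ₗ FermionTorus 2 2) :
    boxCornerEmb ℓ p = rectCellSite (if (ofLex p).1 = 0 then ℓ.1.1 else ℓ.1.2.1) (ofLex p).2 := rfl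

/-- The first copy of an axial link window is the plaquette `c`. [folklore] -/
private theorem inlCell_trans_boxLinkEmb (ℓ : BoxLink M M') :
    inlCell.trans (boxLinkEmb ℓ) = rectCellEmb ℓ.1.1 := by
  ext a
  simp [Function.Embedding.trans_apply]

/-- The second copy of an axial link window is the plaquette `c'`. [folklore] -/
private theorem inrCell_trans_boxLinkEmb (ℓ : BoxLink M M') :
    inrCell.trans (boxLinkEmb ℓ) = rectCellEmb ℓ.1.2.1 := by
  ext a
  simp [Function.Embedding.trans_apply]

/-- The first copy of a corner link window is the plaquette `c`. [folklore] -/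
private theorem inlCell_trans_boxCornerEmb (ℓ : BoxCorner M M') :
    inlCell.trans (boxCornerEmb ℓ) = rectCellEmb ℓ.1.1 := by
  ext a
  simp [Function.Embedding.trans_apply]

/-- The second copy of a corner link window is the plaquette `c'`. [folklore] -/
private theorem inrCell_trans_boxCornerEmb (ℓ : BoxCorner M M') :
    inrCell.trans (boxCornerEmb ℓ) = rectCellEmb ℓ.1.2.1 := by
  ext a
  simp [Function.Embedding.trans_apply]

/-! ### §2. The window graphs carrying the diagonal bonds -/

/-- **The two diagonals of a plaquette** on the offsets `{0,1}²`: both coordinates differ. [folklore] -/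
def plaquetteDiagGraph : SimpleGraph (FermionTorus 2 2) where
  Adj a b := ofLex a 0 ≠ ofLex b 0 ∧ ofLex a 1 ≠ ofLex b 1
  symm := ⟨fun _ _ h => ⟨h.1.symm, h.2.symm⟩⟩
  loopless := ⟨fun _ h => h.1 rfl⟩

/-- Adjacency in the plaquette diagonal graph, unfolded. [folklore] -/
private theorem plaquetteDiagGraph_adj (a b : FermionTorus 2 2) :
    plaquetteDiagGraph.Adj a b ↔ ofLex a 0 ≠ ofLex b 0 ∧ ofLex a 1 ≠ ofLex b 1 := Iff.rfl

/-- Adjacency in the plaquette diagonal graph is decidable. [folklore] -/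
instance instDecidableRelPlaquetteDiagGraphAdj : DecidableRel plaquetteDiagGraph.Adj := fun a b =>
  decidable_of_iff _ (plaquetteDiagGraph_adj a b).symm

/-- The "diagonal link bond" condition between an offset `a` of a plaquette and an offset `b` of the
NEXT plaquette in direction `e`: `a_e = 1`, `b_e = 0`, DIFFERENT transverse coordinates — the two
next-nearest-neighbour bonds `⟨⟨i,j⟩⟩` (`|Δx| = |Δy| = 1`) of LeBlanc et al. (2015) eq. (1) between
axially adjacent plaquettes, in plaquette coordinates. [cite: LeBlancEtAl2015, eq. (1)] -/
def LinkDiag (e : Fin 2) (a b : FermionTorus 2 2) : Prop :=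
  ofLex a e = 1 ∧ ofLex b e = 0 ∧ ∀ j, j ≠ e → ofLex b j ≠ ofLex a j

/-- The diagonal-link condition is decidable. [folklore] -/
instance instDecidableLinkDiag (e : Fin 2) (a b : FermionTorus 2 2) : Decidable (LinkDiag e a b) :=
  inferInstanceAs (Decidable (ofLex a e = 1 ∧ ofLex b e = 0 ∧ ∀ j, j ≠ e → ofLex b j ≠ ofLex a j))

/-- **The diagonal link graph** of direction `e` on the window `{0,1} × {0,1}²` (copy `0` = plaquette
`c`, copy `1` = plaquette `c + e`): the two diagonal bonds joining the `a_e = 1` side of copy `0` to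
the `b_e = 0` side of copy `1`. [folklore] -/
def linkDiagGraph (e : Fin 2) : SimpleGraph (Fin 2 ×ₗ FermionTorus 2 2) where
  Adj p q := ((ofLex p).1 = 0 ∧ (ofLex q).1 = 1 ∧ LinkDiag e (ofLex p).2 (ofLex q).2) ∨
    ((ofLex p).1 = 1 ∧ (ofLex q).1 = 0 ∧ LinkDiag e (ofLex q).2 (ofLex p).2)
  symm := ⟨fun _ _ h => h.elim (fun h => Or.inr ⟨h.2.1, h.1, h.2.2⟩) fun h => Or.inl ⟨h.2.1, h.1, h.2.2⟩⟩
  loopless := ⟨fun _ h => by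
    rcases h with ⟨h0, h1, -⟩ | ⟨h1, h0, -⟩
    · exact absurd (h0.symm.trans h1) (by decide)
    · exact absurd (h0.symm.trans h1) (by decide)⟩

/-- Adjacency in the diagonal link graph, unfolded. [folklore] -/
private theorem linkDiagGraph_adj (e : Fin 2) (p q : Fin 2 ×ₗ FermionTorus 2 2) :
    (linkDiagGraph e).Adj p q ↔ ((ofLex p).1 = 0 ∧ (ofLex q).1 = 1 ∧ LinkDiag e (ofLex p).2 (ofLex q).2) ∨
      ((ofLex p).1 = 1 ∧ (ofLex q).1 = 0 ∧ LinkDiag e (ofLex q).2 (ofLex p).2) := Iff.rfl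

/-- Adjacency in the diagonal link graph is decidable. [folklore] -/
instance instDecidableRelLinkDiagGraphAdj (e : Fin 2) : DecidableRel (linkDiagGraph e).Adj := fun p q =>
  decidable_of_iff _ (linkDiagGraph_adj e p q).symm

/-- The "corner bond" condition between an offset `a` of a plaquette and an offset `b` of the
plaquette `c + (1, 1)` (`d = 0`: `a = (1,1)`, `b = (0,0)`) resp. `c + (1, -1)` (`d = 1`: `a = (1,0)`,
`b = (0,1)`) — the single next-nearest-neighbour bond `⟨⟨i,j⟩⟩` of LeBlanc et al. (2015) eq. (1)
between diagonally adjacent plaquettes. [cite: LeBlancEtAl2015, eq. (1)] -/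
def CornerPair (d : Fin 2) (a b : FermionTorus 2 2) : Prop :=
  ofLex a 0 = 1 ∧ ofLex b 0 = 0 ∧ ofLex a 1 = (if d = 0 then 1 else 0) ∧ ofLex b 1 = (if d = 0 then 0 else 1)

/-- The corner-bond condition is decidable. [folklore] -/
instance instDecidableCornerPair (d : Fin 2) (a b : FermionTorus 2 2) : Decidable (CornerPair d a b) :=
  inferInstanceAs (Decidable (_ ∧ _ ∧ _ ∧ _))

/-- **The corner link graph** of kind `d` on the window `{0,1} × {0,1}²` (copy `0` = plaquette `c`,
copy `1` = plaquette `c + (1, ±1)`): the single diagonal bond between the facing corners. [folklore] -/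
def cornerGraph (d : Fin 2) : SimpleGraph (Fin 2 ×ₗ FermionTorus 2 2) where
  Adj p q := ((ofLex p).1 = 0 ∧ (ofLex q).1 = 1 ∧ CornerPair d (ofLex p).2 (ofLex q).2) ∨
    ((ofLex p).1 = 1 ∧ (ofLex q).1 = 0 ∧ CornerPair d (ofLex q).2 (ofLex p).2)
  symm := ⟨fun _ _ h => h.elim (fun h => Or.inr ⟨h.2.1, h.1, h.2.2⟩) fun h => Or.inl ⟨h.2.1, h.1, h.2.2⟩⟩
  loopless := ⟨fun _ h => by
    rcases h with ⟨h0, h1, -⟩ | ⟨h1, h0, -⟩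
    · exact absurd (h0.symm.trans h1) (by decide)
    · exact absurd (h0.symm.trans h1) (by decide)⟩

/-- Adjacency in the corner link graph, unfolded. [folklore] -/
private theorem cornerGraph_adj (d : Fin 2) (p q : Fin 2 ×ₗ FermionTorus 2 2) :
    (cornerGraph d).Adj p q ↔ ((ofLex p).1 = 0 ∧ (ofLex q).1 = 1 ∧ CornerPair d (ofLex p).2 (ofLex q).2) ∨
      ((ofLex p).1 = 1 ∧ (ofLex q).1 = 0 ∧ CornerPair d (ofLex q).2 (ofLex p).2) := Iff.rfl

/-- Adjacency in the corner link graph is decidable. [folklore] -/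
instance instDecidableRelCornerGraphAdj (d : Fin 2) : DecidableRel (cornerGraph d).Adj := fun p q =>
  decidable_of_iff _ (cornerGraph_adj d p q).symm

section Sums

variable {β : Type*} [AddCommMonoid β]

/-- Sums over the window `{0,1} × {0,1}²` in copy coordinates. [folklore] -/
private theorem sum_window (g : Fin 2 ×ₗ FermionTorus 2 2 → β) :
    ∑ p, g p = ∑ i : Fin 2, ∑ a : FermionTorus 2 2, g (toLex (i, a)) := by
  rw [← (toLex : Fin 2 × FermionTorus 2 2 ≃ Fin 2 ×ₗ FermionTorus 2 2).sum_comp, Fintype.sum_prod_type]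

/-- Sums over the window against the diagonal link graph: the two diagonal bonds, in both
orientations. [folklore] -/
private theorem sum_ite_linkDiagGraph_eq (e : Fin 2) (Y : Fin 2 ×ₗ FermionTorus 2 2 → Fin 2 ×ₗ FermionTorus 2 2 → β) :
    ∑ p, ∑ q, (if (linkDiagGraph e).Adj p q then Y p q else 0) =
      (∑ a : FermionTorus 2 2, ∑ b : FermionTorus 2 2,
          if LinkDiag e a b then Y (toLex (0, a)) (toLex (1, b)) else 0) +
        ∑ a : FermionTorus 2 2, ∑ b : FermionTorus 2 2,
          if LinkDiag e b a then Y (toLex (1, a)) (toLex (0, b)) else 0 := by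
  rw [sum_window]
  have hinner : ∀ i a, (∑ q, if (linkDiagGraph e).Adj (toLex (i, a)) q then Y (toLex (i, a)) q else 0) =
      ∑ j : Fin 2, ∑ b : FermionTorus 2 2,
        if (linkDiagGraph e).Adj (toLex (i, a)) (toLex (j, b)) then Y (toLex (i, a)) (toLex (j, b)) else 0 :=
    fun i a => sum_window _
  simp_rw [hinner]
  simp only [linkDiagGraph_adj, ofLex_toLex, Fin.sum_univ_two, Fin.isValue]
  simp

/-- Sums over the window against the corner link graph: the corner bond, in both orientations.
[folklore] -/
private theorem sum_ite_cornerGraph_eq (d : Fin 2) (Y : Fin 2 ×ₗ FermionTorus 2 2 → Fin 2 ×ₗ FermionTorus 2 2 → β) :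
    ∑ p, ∑ q, (if (cornerGraph d).Adj p q then Y p q else 0) =
      (∑ a : FermionTorus 2 2, ∑ b : FermionTorus 2 2,
          if CornerPair d a b then Y (toLex (0, a)) (toLex (1, b)) else 0) +
        ∑ a : FermionTorus 2 2, ∑ b : FermionTorus 2 2,
          if CornerPair d b a then Y (toLex (1, a)) (toLex (0, b)) else 0 := by
  rw [sum_window]
  have hinner : ∀ i a, (∑ q, if (cornerGraph d).Adj (toLex (i, a)) q then Y (toLex (i, a)) q else 0) =
      ∑ j : Fin 2, ∑ b : FermionTorus 2 2,
        if (cornerGraph d).Adj (toLex (i, a)) (toLex (j, b)) then Y (toLex (i, a)) (toLex (j, b)) else 0 :=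
    fun i a => sum_window _
  simp_rw [hinner]
  simp only [cornerGraph_adj, ofLex_toLex, Fin.sum_univ_two, Fin.isValue]
  simp

end Sums

/-! ### §3. Open-box adjacency in cell coordinates -/

/-- Nearest-neighbour adjacency of the open box, unfolded. [folklore] -/
private theorem rectBoxGraph_adj_iff {a b : ℕ} (p q : Fin a ×ₗ Fin b) :
    (rectBoxGraph a b).Adj p q ↔ ((ofLex p).2 = (ofLex q).2 ∧ lineAdj (ofLex p).1 (ofLex q).1) ∨
      ((ofLex p).1 = (ofLex q).1 ∧ lineAdj (ofLex p).2 (ofLex q).2) := Iff.rfl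

/-- Diagonal adjacency of the open box, unfolded. [folklore] -/
private theorem rectBoxDiagGraph_adj_iff {a b : ℕ} (p q : Fin a ×ₗ Fin b) :
    (rectBoxDiagGraph a b).Adj p q ↔ lineAdj (ofLex p).1 (ofLex q).1 ∧ lineAdj (ofLex p).2 (ofLex q).2 :=
  Iff.rfl

section Pointwise

variable {β : Type*} [AddCommMonoid β]

/-- **The indicator of open-box nearest-neighbour adjacency splits over plaquette edges and axial
link bonds** (pointwise form of the tiling; the alternatives are mutually exclusive). [folklore] -/
private theorem ite_boxAdj_cellSite_eq (c c' : Fin M × Fin M') (a b : FermionTorus 2 2) (x : β) :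
    (if (rectBoxGraph (M * 2) (M' * 2)).Adj (rectCellSite c a) (rectCellSite c' b) then x else 0) =
      (if c' = c ∧ plaquetteGraph.Adj a b then x else 0) +
        ∑ e : Fin 2, ((if IsStep e c c' ∧ LinkMid e a b then x else 0) +
          (if IsStep e c' c ∧ LinkMid e b a then x else 0)) := by
  obtain ⟨c₁, c₂⟩ := c
  obtain ⟨c₁', c₂'⟩ := c'
  simp only [rectBoxGraph_adj_iff, ofLex_rectCellSite_fst', ofLex_rectCellSite_snd', EmbeddingLike.apply_eq_iff_eq,
    Prod.mk.injEq, lineAdj, finProdFinEquiv_apply_val, plaquetteGraph_adj, ne_eq, offset_eq_iff', LinkMid,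
    IsStep, Fin.exists_fin_two, Fin.forall_fin_two, Fin.sum_univ_two, Fin.isValue, Fin.ext_iff]
  generalize ofLex a 0 = a0, ofLex a 1 = a1, ofLex b 0 = b0, ofLex b 1 = b1 at *
  fin_cases a0 <;> fin_cases a1 <;> fin_cases b0 <;> fin_cases b1 <;> simp <;> (try split_ifs) <;>
    first | rfl | (simp only [add_zero, zero_add]; done) |
      (intros; exfalso; omega)

/-- **The indicator of open-box diagonal adjacency splits over plaquette diagonals, axial-link
diagonals and corner bonds** (pointwise; mutually exclusive alternatives). [folklore] -/
private theorem ite_boxDiagAdj_cellSite_eq (c c' : Fin M × Fin M') (a b : FermionTorus 2 2) (x : β) :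
    (if (rectBoxDiagGraph (M * 2) (M' * 2)).Adj (rectCellSite c a) (rectCellSite c' b) then x else 0) =
      (if c' = c ∧ plaquetteDiagGraph.Adj a b then x else 0) +
        ∑ e : Fin 2, ((if IsStep e c c' ∧ LinkDiag e a b then x else 0) +
          (if IsStep e c' c ∧ LinkDiag e b a then x else 0)) +
        ∑ d : Fin 2, ((if IsCorner d c c' ∧ CornerPair d a b then x else 0) +
          (if IsCorner d c' c ∧ CornerPair d b a then x else 0)) := by
  obtain ⟨c₁, c₂⟩ := c
  obtain ⟨c₁', c₂'⟩ := c'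
  simp only [rectBoxDiagGraph_adj_iff, ofLex_rectCellSite_fst', ofLex_rectCellSite_snd',
    lineAdj, finProdFinEquiv_apply_val, plaquetteDiagGraph_adj, ne_eq, LinkDiag, CornerPair,
    IsStep, IsCorner, Fin.forall_fin_two, Fin.sum_univ_two, Fin.isValue, Fin.ext_iff, Prod.mk.injEq]
  generalize ofLex a 0 = a0, ofLex a 1 = a1, ofLex b 0 = b0, ofLex b 1 = b1 at *
  fin_cases a0 <;> fin_cases a1 <;> fin_cases b0 <;> fin_cases b1 <;> simp <;> (try split_ifs) <;>
    first | rfl | (simp only [add_zero, zero_add]; done) |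
      (intros; exfalso; omega)

end Pointwise

/-! ### §4. The bond partition of the open-box `t–t'` Hamiltonian -/

section Tiling

variable {β : Type*} [AddCommMonoid β]

/-- Summing over the box in cell coordinates (pairs). [folklore] -/
private theorem sum_rectCellSite_pair (f : Fin (M * 2) ×ₗ Fin (M' * 2) → β) :
    ∑ x, f x = ∑ p : (Fin M × Fin M') × FermionTorus 2 2, f (rectCellSite p.1 p.2) :=
  (rectCellSite_bijective'.sum_comp f).symm

/-- Summing over the box in cell coordinates (iterated). [folklore] -/
private theorem sum_rectCellSite' (f : Fin (M * 2) ×ₗ Fin (M' * 2) → β) :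
    ∑ x, f x = ∑ c : Fin M × Fin M', ∑ a : FermionTorus 2 2, f (rectCellSite c a) := by
  rw [sum_rectCellSite_pair, Fintype.sum_prod_type]

/-- A triple sum against the indicator of a relation on plaquette pairs is a sum over the subtype
of related triples. [folklore] -/
private theorem sum_ite_rel_eq_sum_subtype (R : Fin 2 → (Fin M × Fin M') → (Fin M × Fin M') → Prop)
    [∀ e c c', Decidable (R e c c')] (G : (Fin M × Fin M') → (Fin M × Fin M') → Fin 2 → β) :
    ∑ c, ∑ c', ∑ e, (if R e c c' then G c c' e else 0) =
      ∑ ℓ : {ℓ : (Fin M × Fin M') × (Fin M × Fin M') × Fin 2 // R ℓ.2.2 ℓ.1 ℓ.2.1},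
        G ℓ.1.1 ℓ.1.2.1 ℓ.1.2.2 := by
  symm
  calc ∑ ℓ : {ℓ : (Fin M × Fin M') × (Fin M × Fin M') × Fin 2 // R ℓ.2.2 ℓ.1 ℓ.2.1},
        G ℓ.1.1 ℓ.1.2.1 ℓ.1.2.2
      = ∑ ℓ ∈ univ.filter (fun ℓ : (Fin M × Fin M') × (Fin M × Fin M') × Fin 2 => R ℓ.2.2 ℓ.1 ℓ.2.1),
          G ℓ.1 ℓ.2.1 ℓ.2.2 :=
        (Finset.sum_subtype (p := fun ℓ : (Fin M × Fin M') × (Fin M × Fin M') × Fin 2 => R ℓ.2.2 ℓ.1 ℓ.2.1) _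
          (fun ℓ => by simp) (fun ℓ : (Fin M × Fin M') × (Fin M × Fin M') × Fin 2 => G ℓ.1 ℓ.2.1 ℓ.2.2)).symm
    _ = ∑ ℓ : (Fin M × Fin M') × (Fin M × Fin M') × Fin 2,
          if R ℓ.2.2 ℓ.1 ℓ.2.1 then G ℓ.1 ℓ.2.1 ℓ.2.2 else 0 := Finset.sum_filter _ _
    _ = ∑ c, ∑ c', ∑ e, if R e c c' then G c c' e else 0 := by
        rw [Fintype.sum_prod_type (α₁ := Fin M × Fin M') (α₂ := (Fin M × Fin M') × Fin 2)]
        exact Finset.sum_congr rfl fun c _ => Fintype.sum_prod_type (α₁ := Fin M × Fin M') (α₂ := Fin 2) _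

/-- **Packaging of link bonds**: a double sum over plaquette-offset pairs against
`[R e c c' ∧ L e a b]` is the sum over the related triples `ℓ = (c, c', e)` of the offset sums
against `[L e a b]`. [folklore] -/
private theorem sum_pair_ite_rel_eq (R : Fin 2 → (Fin M × Fin M') → (Fin M × Fin M') → Prop)
    [∀ e c c', Decidable (R e c c')] (L : Fin 2 → FermionTorus 2 2 → FermionTorus 2 2 → Prop)
    [∀ e a b, Decidable (L e a b)]
    (G : (Fin M × Fin M') × FermionTorus 2 2 → (Fin M × Fin M') × FermionTorus 2 2 → β) :
    ∑ p : (Fin M × Fin M') × FermionTorus 2 2, ∑ q : (Fin M × Fin M') × FermionTorus 2 2, ∑ e : Fin 2,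
        (if R e p.1 q.1 ∧ L e p.2 q.2 then G p q else 0) =
      ∑ ℓ : {ℓ : (Fin M × Fin M') × (Fin M × Fin M') × Fin 2 // R ℓ.2.2 ℓ.1 ℓ.2.1},
        ∑ a : FermionTorus 2 2, ∑ b : FermionTorus 2 2,
          if L ℓ.1.2.2 a b then G (ℓ.1.1, a) (ℓ.1.2.1, b) else 0 := by
  rw [← sum_ite_rel_eq_sum_subtype R (fun c c' e => ∑ a : FermionTorus 2 2, ∑ b : FermionTorus 2 2,
    if L e a b then G (c, a) (c', b) else 0)]
  simp only [Fintype.sum_prod_type (α₁ := Fin M × Fin M') (α₂ := FermionTorus 2 2), ite_and]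
  refine Finset.sum_congr rfl fun c _ => ?_
  rw [Finset.sum_comm]
  refine Finset.sum_congr rfl fun c' _ => ?_
  rw [sum_sum_sum_comm]
  refine Finset.sum_congr rfl fun e _ => ?_
  simp only [Finset.sum_ite_irrel, Finset.sum_const_zero]

/-- Plaquette terms: the sum over pairs against `[c' = c ∧ Q a b]` is the sum over plaquettes of the
offset sums against `[Q a b]`. [folklore] -/
private theorem sum_pair_ite_eq_cell (Q : FermionTorus 2 2 → FermionTorus 2 2 → Prop) [∀ a b, Decidable (Q a b)]
    (G : (Fin M × Fin M') × FermionTorus 2 2 → (Fin M × Fin M') × FermionTorus 2 2 → β) :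
    ∑ p : (Fin M × Fin M') × FermionTorus 2 2, ∑ q : (Fin M × Fin M') × FermionTorus 2 2,
        (if q.1 = p.1 ∧ Q p.2 q.2 then G p q else 0) =
      ∑ c : Fin M × Fin M', ∑ a : FermionTorus 2 2, ∑ b : FermionTorus 2 2,
        if Q a b then G (c, a) (c, b) else 0 := by
  simp only [Fintype.sum_prod_type (α₁ := Fin M × Fin M') (α₂ := FermionTorus 2 2), ite_and]
  refine Finset.sum_congr rfl fun c _ => Finset.sum_congr rfl fun a _ => ?_
  rw [Finset.sum_comm]
  refine Finset.sum_congr rfl fun b _ => ?_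
  rw [Finset.sum_ite_eq' univ c, if_pos (mem_univ _)]

/-- **Tiling of the open-box nearest-neighbour bonds**: a sum over the ordered nearest-neighbour pairs
of the open `2M × 2M'` box is the sum over the ordered edges of the `M·M'` plaquettes plus, for every
axial link `ℓ = (c, c', e)`, the sum over the two middle bonds of its window (in both orientations).
[folklore] -/
private theorem sum_ite_boxAdj_eq
    (F : Fin (M * 2) ×ₗ Fin (M' * 2) → Fin (M * 2) ×ₗ Fin (M' * 2) → β) :
    ∑ x, ∑ y, (if (rectBoxGraph (M * 2) (M' * 2)).Adj x y then F x y else 0) =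
      ∑ c : Fin M × Fin M', ∑ a : FermionTorus 2 2, ∑ b : FermionTorus 2 2,
          (if plaquetteGraph.Adj a b then F (rectCellSite c a) (rectCellSite c b) else 0) +
        ∑ ℓ : BoxLink M M', ∑ p, ∑ q,
          (if (linkGraph ℓ.1.2.2).Adj p q then F (boxLinkEmb ℓ p) (boxLinkEmb ℓ q) else 0) := by
  simp only [sum_rectCellSite_pair, ite_boxAdj_cellSite_eq, Finset.sum_add_distrib]
  congr 1
  · exact sum_pair_ite_eq_cell _ fun p q => F (rectCellSite p.1 p.2) (rectCellSite q.1 q.2)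
  · rw [sum_pair_ite_rel_eq IsStep LinkMid fun p q => F (rectCellSite p.1 p.2) (rectCellSite q.1 q.2),
      Finset.sum_comm (f := fun p q : (Fin M × Fin M') × FermionTorus 2 2 => ∑ e : Fin 2,
        if IsStep e q.1 p.1 ∧ LinkMid e q.2 p.2 then F (rectCellSite p.1 p.2) (rectCellSite q.1 q.2) else 0),
      sum_pair_ite_rel_eq IsStep LinkMid fun p q => F (rectCellSite q.1 q.2) (rectCellSite p.1 p.2),
      ← Finset.sum_add_distrib]
    refine Finset.sum_congr rfl fun ℓ _ => ?_
    rw [sum_ite_linkGraph_eq]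
    simp only [boxLinkEmb_apply, ofLex_toLex, Fin.isValue, ↓reduceIte, one_ne_zero]
    congr 1
    rw [Finset.sum_comm]

/-- **Tiling of the open-box diagonal bonds**: a sum over the ordered next-nearest-neighbour pairs of
the open `2M × 2M'` box is the sum over the ordered plaquette diagonals plus, for every axial link, the
two diagonal bonds of its window, plus, for every corner link, its single corner bond (all in both
orientations). [folklore] -/
private theorem sum_ite_boxDiagAdj_eq
    (F : Fin (M * 2) ×ₗ Fin (M' * 2) → Fin (M * 2) ×ₗ Fin (M' * 2) → β) :
    ∑ x, ∑ y, (if (rectBoxDiagGraph (M * 2) (M' * 2)).Adj x y then F x y else 0) =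
      ∑ c : Fin M × Fin M', ∑ a : FermionTorus 2 2, ∑ b : FermionTorus 2 2,
          (if plaquetteDiagGraph.Adj a b then F (rectCellSite c a) (rectCellSite c b) else 0) +
        (∑ ℓ : BoxLink M M', ∑ p, ∑ q,
            (if (linkDiagGraph ℓ.1.2.2).Adj p q then F (boxLinkEmb ℓ p) (boxLinkEmb ℓ q) else 0) +
          ∑ ℓ : BoxCorner M M', ∑ p, ∑ q,
            (if (cornerGraph ℓ.1.2.2).Adj p q then F (boxCornerEmb ℓ p) (boxCornerEmb ℓ q) else 0)) := by
  simp only [sum_rectCellSite_pair, ite_boxDiagAdj_cellSite_eq, Finset.sum_add_distrib]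
  rw [add_assoc]
  congr 1
  · exact sum_pair_ite_eq_cell _ fun p q => F (rectCellSite p.1 p.2) (rectCellSite q.1 q.2)
  · congr 1
    · rw [sum_pair_ite_rel_eq IsStep LinkDiag fun p q => F (rectCellSite p.1 p.2) (rectCellSite q.1 q.2),
        Finset.sum_comm (f := fun p q : (Fin M × Fin M') × FermionTorus 2 2 => ∑ e : Fin 2,
          if IsStep e q.1 p.1 ∧ LinkDiag e q.2 p.2 then F (rectCellSite p.1 p.2) (rectCellSite q.1 q.2) else 0),
        sum_pair_ite_rel_eq IsStep LinkDiag fun p q => F (rectCellSite q.1 q.2) (rectCellSite p.1 p.2),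
        ← Finset.sum_add_distrib]
      refine Finset.sum_congr rfl fun ℓ _ => ?_
      rw [sum_ite_linkDiagGraph_eq]
      simp only [boxLinkEmb_apply, ofLex_toLex, Fin.isValue, ↓reduceIte, one_ne_zero]
      congr 1
      rw [Finset.sum_comm]
    · rw [sum_pair_ite_rel_eq IsCorner CornerPair fun p q => F (rectCellSite p.1 p.2) (rectCellSite q.1 q.2),
        Finset.sum_comm (f := fun p q : (Fin M × Fin M') × FermionTorus 2 2 => ∑ d : Fin 2,
          if IsCorner d q.1 p.1 ∧ CornerPair d q.2 p.2 then F (rectCellSite p.1 p.2) (rectCellSite q.1 q.2) else 0),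
        sum_pair_ite_rel_eq IsCorner CornerPair fun p q => F (rectCellSite q.1 q.2) (rectCellSite p.1 p.2),
        ← Finset.sum_add_distrib]
      refine Finset.sum_congr rfl fun ℓ _ => ?_
      rw [sum_ite_cornerGraph_eq]
      simp only [boxCornerEmb_apply, ofLex_toLex, Fin.isValue, ↓reduceIte, one_ne_zero]
      congr 1
      rw [Finset.sum_comm]

end Tiling

/-- **Bond partition of the `t–t'` Hamiltonian of the open `2M × 2M'` box**:
`H = Σ_c Γ(rectCellEmb c)(H_plaq(t,U) + D_plaq(t')) + (Σ_{ℓ axial} Γ(boxLinkEmb ℓ)(T_e(t) + D_e(t'))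
  + Σ_{ℓ corner} Γ(boxCornerEmb ℓ) C_d(t'))`, with `H_plaq = hamiltonian plaquetteGraph t U`,
`D_plaq = hamiltonian plaquetteDiagGraph t' 0`, `T_e = hamiltonian (linkGraph e) t 0`,
`D_e = hamiltonian (linkDiagGraph e) t' 0`, `C_d = hamiltonian (cornerGraph d) t' 0`. [folklore] -/
private theorem openBox_hamiltonian_eq_sum_cells_add_sum_links (t t' U : ℝ) :
    hubbardOpenBoxTT' (M * 2) (M' * 2) t t' U =
      ∑ c : Fin M × Fin M', fermionEmbed (rectCellEmb c)
          (hamiltonian plaquetteGraph t U + hamiltonian plaquetteDiagGraph t' 0) +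
        (∑ ℓ : BoxLink M M', fermionEmbed (boxLinkEmb ℓ)
            (hamiltonian (linkGraph ℓ.1.2.2) t 0 + hamiltonian (linkDiagGraph ℓ.1.2.2) t' 0) +
          ∑ ℓ : BoxCorner M M', fermionEmbed (boxCornerEmb ℓ) (hamiltonian (cornerGraph ℓ.1.2.2) t' 0)) := by
  rw [hubbardOpenBoxTT', hamiltonian, hamiltonian]
  simp only [sum_ite_const_cond]
  rw [sum_ite_boxAdj_eq, sum_ite_boxDiagAdj_eq,
    sum_rectCellSite' (fun x => numberOp x 0 * numberOp x 1)]
  simp only [fermionEmbed_add, fermionEmbed_hamiltonian, rectCellEmb_apply', Complex.ofReal_zero, zero_smul,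
    add_zero, sum_ite_const_cond, Finset.sum_add_distrib, ← Finset.smul_sum, smul_add]
  abel

/-! ### §5. The bound -/

set_option maxHeartbeats 800000 in
/-- **The plaquette-dressed Slater (local-unitary-cluster) bound on the OPEN `2M × 2M'` box with
`t–t'` hopping.** For all real `t, t', U`, every orthogonal projection `P` on the one-particle space
of the box with `tr P = N`, and every family of particle-number conserving unitaries `u_c` of the
plaquette Fock space (`u_cᴴ u_c = 1`, `[N̂, u_c] = 0`),
`E^{open}_{2M×2M'}(t,t',U;N) ≤ Re [ Σ_c Σ_{s,t} (u_cᴴ (H_plaq + D_plaq) u_c)_{st} · slaterRDM (P|_{cell c}) s t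
   + Σ_{ℓ : BoxLink} Σ_{s,t} (V_ℓᴴ (T_e + D_e) V_ℓ)_{st} · slaterRDM (P|_{boxLinkEmb ℓ}) s t
   + Σ_{ℓ : BoxCorner} Σ_{s,t} (V_ℓᴴ C_d V_ℓ)_{st} · slaterRDM (P|_{boxCornerEmb ℓ}) s t ]`,
`V_ℓ = Γ(inlCell) u_c · Γ(inrCell) u_{c'}` for `ℓ = (c, c', ·)`: the energy of the dressed Slater
determinant `(∏_c Γ(rectCellEmb c) u_c) Φ_P`, an explicit polynomial in the window entries of `P` and
the entries of the `u_c` (`DressedCluster.groundEnergy_le` + the bond partition). No hypothesis on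
`M, M'` (free boundary: no wrap-around). [cite: BachLiebSolovej1994, eq. (2c.36)] -/
theorem groundEnergy_openBox_le_dressed (t t' U : ℝ)
    {P : Matrix (Orb (Fin (M * 2) ×ₗ Fin (M' * 2))) (Orb (Fin (M * 2) ×ₗ Fin (M' * 2))) ℂ}
    (hP : P.IsHermitian) (hPP : P * P = P) {N : ℕ} (htr : P.trace = N)
    (u : Fin M × Fin M' → Matrix (Finset (Orb (FermionTorus 2 2))) (Finset (Orb (FermionTorus 2 2))) ℂ)
    (hu : ∀ c, (u c)ᴴ * u c = 1) (huN : ∀ c, Commute totalNumberOp (u c)) :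
    groundEnergy (hubbardOpenBoxTT' (M * 2) (M' * 2) t t' U) N ≤
      ((∑ c : Fin M × Fin M', ∑ s : Finset (Orb (FermionTorus 2 2)), ∑ s' : Finset (Orb (FermionTorus 2 2)),
          ((u c)ᴴ * (hamiltonian plaquetteGraph t U + hamiltonian plaquetteDiagGraph t' 0) * u c) s s' *
            HartreeFock.slaterRDM (P.submatrix (fun a => orb (rectCellEmb c (ofLex a).1) (ofLex a).2)
              (fun a => orb (rectCellEmb c (ofLex a).1) (ofLex a).2)) s s') +
        (∑ ℓ : BoxLink M M', ∑ s : Finset (Orb (Fin 2 ×ₗ FermionTorus 2 2)),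
            ∑ s' : Finset (Orb (Fin 2 ×ₗ FermionTorus 2 2)),
              ((fermionEmbed inlCell (u ℓ.1.1) * fermionEmbed inrCell (u ℓ.1.2.1))ᴴ *
                  (hamiltonian (linkGraph ℓ.1.2.2) t 0 + hamiltonian (linkDiagGraph ℓ.1.2.2) t' 0) *
                (fermionEmbed inlCell (u ℓ.1.1) * fermionEmbed inrCell (u ℓ.1.2.1))) s s' *
              HartreeFock.slaterRDM (P.submatrix (fun a => orb (boxLinkEmb ℓ (ofLex a).1) (ofLex a).2)
                (fun a => orb (boxLinkEmb ℓ (ofLex a).1) (ofLex a).2)) s s' +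
          ∑ ℓ : BoxCorner M M', ∑ s : Finset (Orb (Fin 2 ×ₗ FermionTorus 2 2)),
            ∑ s' : Finset (Orb (Fin 2 ×ₗ FermionTorus 2 2)),
              ((fermionEmbed inlCell (u ℓ.1.1) * fermionEmbed inrCell (u ℓ.1.2.1))ᴴ *
                  hamiltonian (cornerGraph ℓ.1.2.2) t' 0 *
                (fermionEmbed inlCell (u ℓ.1.1) * fermionEmbed inrCell (u ℓ.1.2.1))) s s' *
              HartreeFock.slaterRDM (P.submatrix (fun a => orb (boxCornerEmb ℓ (ofLex a).1) (ofLex a).2)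
                (fun a => orb (boxCornerEmb ℓ (ofLex a).1) (ofLex a).2)) s s')).re := by
  have hH := openBox_hamiltonian_eq_sum_cells_add_sum_links (M := M) (M' := M') t t' U
  have h := DressedCluster.groundEnergy_le (φ := rectCellEmb) (hdisj := fun _ _ h => disjoint_rectCellEmb' h)
    (u := u) (huN := huN) (D := BoxLink M M' ⊕ BoxCorner M M')
    (ψ := Sum.elim boxLinkEmb boxCornerEmb)
    (src := Sum.elim (fun ℓ => ℓ.1.1) (fun ℓ => ℓ.1.1)) (tgt := Sum.elim (fun ℓ => ℓ.1.2.1) (fun ℓ => ℓ.1.2.1))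
    (ι₁ := inlCell) (ι₂ := inrCell)
    (hne := by rintro (ℓ | ℓ); exacts [ℓ.2.ne, ℓ.2.ne])
    (hsrc := by rintro (ℓ | ℓ); exacts [inlCell_trans_boxLinkEmb ℓ, inlCell_trans_boxCornerEmb ℓ])
    (htgt := by rintro (ℓ | ℓ); exacts [inrCell_trans_boxLinkEmb ℓ, inrCell_trans_boxCornerEmb ℓ])
    (hcover := mem_range_inlCell_or_inrCell)
    hP hPP htr (hu := fun c => by convert hu c) (H := hubbardOpenBoxTT' (M * 2) (M' * 2) t t' U)
    (h₁ := fun _ => hamiltonian plaquetteGraph t U + hamiltonian plaquetteDiagGraph t' 0)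
    (h₂ := Sum.elim (fun ℓ => hamiltonian (linkGraph ℓ.1.2.2) t 0 + hamiltonian (linkDiagGraph ℓ.1.2.2) t' 0)
      (fun ℓ => hamiltonian (cornerGraph ℓ.1.2.2) t' 0))
    (by rw [hH]; simp only [Fintype.sum_sum_type, Sum.elim_inl, Sum.elim_inr])
  simp only [Fintype.sum_sum_type, Sum.elim_inl, Sum.elim_inr] at h
  convert h using 3

/-- **Thermodynamic-limit corollary** (`U ≥ 0`, `N < 8MM'`): the `t–t'` ground-state energy density
at filling `N/(4MM')` is at most the dressed-Slater energy of the open `2M × 2M'` box per site —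
`ThermodynamicLimit.energyDensityTT'_le_openBox` (one free cluster bounds the energy density from
above) composed with `groundEnergy_openBox_le_dressed`. [cite: Ruelle1969, §3.3] -/
theorem energyDensityTT'_le_openBox_dressed (t t' : ℝ) {U : ℝ} (hU : 0 ≤ U) (hM : 1 ≤ M) (hM' : 1 ≤ M')
    {P : Matrix (Orb (Fin (M * 2) ×ₗ Fin (M' * 2))) (Orb (Fin (M * 2) ×ₗ Fin (M' * 2))) ℂ}
    (hP : P.IsHermitian) (hPP : P * P = P) {N : ℕ} (htr : P.trace = N) (hN : N < 2 * (M * 2 * (M' * 2)))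
    (u : Fin M × Fin M' → Matrix (Finset (Orb (FermionTorus 2 2))) (Finset (Orb (FermionTorus 2 2))) ℂ)
    (hu : ∀ c, (u c)ᴴ * u c = 1) (huN : ∀ c, Commute totalNumberOp (u c)) :
    ThermodynamicLimit.energyDensityTT' t t' U ((N : ℝ) / (((M * 2 : ℕ) : ℝ) * ((M' * 2 : ℕ) : ℝ))) ≤
      ((∑ c : Fin M × Fin M', ∑ s : Finset (Orb (FermionTorus 2 2)), ∑ s' : Finset (Orb (FermionTorus 2 2)),
          ((u c)ᴴ * (hamiltonian plaquetteGraph t U + hamiltonian plaquetteDiagGraph t' 0) * u c) s s' *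
            HartreeFock.slaterRDM (P.submatrix (fun a => orb (rectCellEmb c (ofLex a).1) (ofLex a).2)
              (fun a => orb (rectCellEmb c (ofLex a).1) (ofLex a).2)) s s') +
        (∑ ℓ : BoxLink M M', ∑ s : Finset (Orb (Fin 2 ×ₗ FermionTorus 2 2)),
            ∑ s' : Finset (Orb (Fin 2 ×ₗ FermionTorus 2 2)),
              ((fermionEmbed inlCell (u ℓ.1.1) * fermionEmbed inrCell (u ℓ.1.2.1))ᴴ *
                  (hamiltonian (linkGraph ℓ.1.2.2) t 0 + hamiltonian (linkDiagGraph ℓ.1.2.2) t' 0) *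
                (fermionEmbed inlCell (u ℓ.1.1) * fermionEmbed inrCell (u ℓ.1.2.1))) s s' *
              HartreeFock.slaterRDM (P.submatrix (fun a => orb (boxLinkEmb ℓ (ofLex a).1) (ofLex a).2)
                (fun a => orb (boxLinkEmb ℓ (ofLex a).1) (ofLex a).2)) s s' +
          ∑ ℓ : BoxCorner M M', ∑ s : Finset (Orb (Fin 2 ×ₗ FermionTorus 2 2)),
            ∑ s' : Finset (Orb (Fin 2 ×ₗ FermionTorus 2 2)),
              ((fermionEmbed inlCell (u ℓ.1.1) * fermionEmbed inrCell (u ℓ.1.2.1))ᴴ *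
                  hamiltonian (cornerGraph ℓ.1.2.2) t' 0 *
                (fermionEmbed inlCell (u ℓ.1.1) * fermionEmbed inrCell (u ℓ.1.2.1))) s s' *
              HartreeFock.slaterRDM (P.submatrix (fun a => orb (boxCornerEmb ℓ (ofLex a).1) (ofLex a).2)
                (fun a => orb (boxCornerEmb ℓ (ofLex a).1) (ofLex a).2)) s s')).re /
        (((M * 2 : ℕ) : ℝ) * ((M' * 2 : ℕ) : ℝ)) := by
  have h1 := ThermodynamicLimit.energyDensityTT'_le_openBox t t' hU (a := M * 2) (b := M' * 2)
    (by omega) (by omega) hN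
  refine h1.trans (div_le_div_of_nonneg_right (groundEnergy_openBox_le_dressed t t' U hP hPP htr u hu huN) ?_)
  positivity

end PlaquetteLUC

end Literature.MathematicalPhysics.QuantumLattice

end
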